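import Summits.NavierStokesRegularity.NavierStokesRegularity.Theorems.StrainClockLocalDefs
import Summits.NavierStokesRegularity.NavierStokesRegularity.Theorems.StrainDoorsDefs
import Literature.Analysis.FluidPDE.TimeDependentLinearFlow
import HarnessLib

/-!
# DriftChargedClockInhabitant — EQUALITY CASE of door S40-D1 «DriftChargedSmoothing» (satisfiability certificate, ref3 F2)

P0-40 part 4 of 4: §1–§7 of nsreg-p1 g32's `r38/Sketch41.lean` sha16 7b65a980320147fc (ROUND-38 v1.1 de833dab5ad7c014 §4(b1)):
namespace `…Theorems.StrainDoors.PlanarStrain` (decaying planar strain `u(t,x) = (κt + a₀⁻¹)⁻¹(x₀,−x₁,0)`, Craik–Criminale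
pressure; `isClassicalNSSolutionOn`, `fderiv_bound`, `strainQuad_u`, `curl_u`, `strainFeed_u`, `isStrainPenalisedArgmax_origin`,
`eq_of_isStrainPenalisedArgmax`, `totalFeed_eq_of_isStrainPenalisedArgmax`, `driftCharged_hypothesis`, `charged_origin`), then
`driftChargedSmoothing_inhabited`. Statements and proofs byte-identical, order preserved (one-line docstrings ADDED on 12 helper
lemmas for the gate's lint); §0 (`IsStrainPenalisedArgmax`) DROPPED → `import …Theorems.StrainClockLocalDefs` (p667521) per memo
§8; independent of parts 1–3; cut by ns-s29-p2 g5, `--supports stmt-NavierStokesRegularity-0056 --as helper`. Sketch docstring verbatim below.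
HONEST FRAME: an explicit infinite-energy EXAMPLE (D1's hypothesis met with equality; its `1/(κt)` term sharp); not a theorem about
NS regularity; items 0056 `NoTypeII`, 10661 and NS regularity are NOT proved; nothing here is a route or a summit statement.
-/


/-!
# Sketch41 — the EQUALITY CASE of door D1 «DriftChargedSmoothing» (nsreg-p1 g32, ROUND-38 addendum):
# a kernel-checked INHABITANT of D1's frame and hypothesis (satisfiability certificate, ref3 F2)

ROUND-38 (Sketch40) proved the forward door D1 `DriftChargedSmoothing`: in S33's blow-up-permitting frame
(classical Navier–Stokes on `[0,T)`, `∇u` bounded on closed sub-slabs, NO velocity bound), if at every exact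
`ε`-penalised strain maximiser `(x̄,ē)` charged above the level `ℓ` the TOTAL feed obeys
`H + √ε‖u(x̄)‖q ≤ c q²` (`c < 1`, `κ = 1 − c`), then `(1+ε‖x‖²)⁻¹⟪∇u(t,x)e,e⟫ ≤ ℓ + 6νε/κ + 1/(κ(t−t₀))` on `(t₀,T)`.
The referee's first test of any such conditional criterion (ref3 SCORE-p1-ROUND-36 F2) is SATISFIABILITY: is the
hypothesis met, non-vacuously, by an actual Navier–Stokes flow? This file answers it IN LEAN for D1 (with `t₀ = 0`):

* the decaying planar strain `u(t,x) = a(t)·(x₀, −x₁, 0)`, `a(t) = (κt + a₀⁻¹)⁻¹`, with the Craik–Criminale pressure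
  `p(t,x) = −½⟪x, (S′ + S²)(t) x⟫` (`S(t) = a(t)·diag(1,−1,0)`, `S′ = −κa²·diag(1,−1,0)`), is a classical
  Navier–Stokes solution on `[0,T) × ℝ³` for every viscosity (tree: `LinearFlow.isClassicalNSSolutionOn`,
  Craik–Criminale 1986 / Drazin 2002 Ex. 2.19) — `planarStrain_isClassicalNSSolutionOn`;
* its velocity gradient is bounded on `[0,T)` by `a₀‖diag(1,−1,0)‖` — `planarStrain_fderiv_bound`;
* `⟪∇u(t,x)e,e⟫ = a(t)(e₀² − e₁²)`, `curl u ≡ 0`, `H(t,x,e) = a(t)²((1−κ)e₀² + (1+κ)e₁²)` —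
  `strainQuad_planarStrain`, `curl_planarStrain`, `strainFeed_planarStrain`;
* the exact `ε`-penalised maximisers are EXACTLY `(0, ±e₀)` (`isStrainPenalisedArgmax_planarStrain_origin`,
  `eq_zero_of_isStrainPenalisedArgmax_planarStrain`), the weighted strain there is `a(t)` (so every level
  `ℓ < a(T⁻) = (κT + a₀⁻¹)⁻¹` is CHARGED at every time), `u(t,0) = 0`, and the total feed is `(1−κ)a² = c·q²`:
  D1's hypothesis holds with EQUALITY — `driftCharged_hypothesis_planarStrain`;
* packaged in D1's binder shapes: `driftChargedSmoothing_inhabited`.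

Consequently D1's conclusion at the charged point reads `(κt + a₀⁻¹)⁻¹ ≤ ℓ + 6νε/κ + (κt)⁻¹`: the `1/(κ(t−t₀))` term of
D1 is SHARP (let `a₀ → ∞`, then `ε → 0`, `ℓ → 0`). The flow has unbounded velocity (`‖u(t,x)‖ = a(t)‖(x₀,x₁)‖`), so it
inhabits D1's velocity-free frame but NOT S39-C3's (`‖u‖ ≤ U`) nor A0/D4's (`H¹ ∩ Ḣ^m` Sobolev frame) — those need a
decaying finite-energy instance (ROUND-38 §9, S-lane kit item).

HONEST LABEL: an example, not a theorem about Navier–Stokes regularity; infinite energy, outside every Clay class.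
WHAT THIS IS NOT: items 0056 / 10661 are not touched; no Literature fact is a hypothesis; nothing here is a route.
§0 re-declares `IsStrainPenalisedArgmax` verbatim from Sketch39/40 (P0-39 pending) — drop on landing.
-/

set_option linter.dupNamespace false

open Set Function WithLp Filter
open scoped ContDiff InnerProductSpace RealInnerProductSpace Topology

namespace Summit.NavierStokesRegularity.NavierStokesRegularity.Theorems.StrainDoors

open Literature.Analysis.FluidPDE Literature.Analysis.FluidPDE.VectorCalculus

noncomputable section

namespace PlanarStrain

/-! ## §1 The planar strain `diag(1,−1,0)` as a continuous linear map on `ℝ³` -/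

/-- support (definition): `x ↦ (x₀, −x₁, 0)`. -/
def strainFun (x : EuclideanSpace ℝ (Fin 3)) : EuclideanSpace ℝ (Fin 3) := toLp 2 ![x 0, -x 1, 0]

/-- support (definition): `diag(1,−1,0)` as a continuous linear map. -/
def D : EuclideanSpace ℝ (Fin 3) →L[ℝ] EuclideanSpace ℝ (Fin 3) :=
  LinearMap.toContinuousLinearMap
    { toFun := strainFun
      map_add' := fun v w => by ext i; fin_cases i <;> (simp [strainFun]; try ring)
      map_smul' := fun c v => by ext i; fin_cases i <;> (simp [strainFun]; try ring) }

/-- `D x = (x₀, −x₁, 0)` (unfolding lemma). -/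
@[simp] theorem D_apply (x : EuclideanSpace ℝ (Fin 3)) : D x = toLp 2 ![x 0, -x 1, 0] := rfl

/-- `⟪D x, y⟫ = x₀y₀ − x₁y₁`. -/
theorem inner_D (x y : EuclideanSpace ℝ (Fin 3)) : ⟪D x, y⟫ = x 0 * y 0 - x 1 * y 1 := by
  simp [PiLp.inner_apply, Fin.sum_univ_three]
  ring

/-- `⟪D (D x), y⟫ = x₀y₀ + x₁y₁`. -/
theorem inner_D_D (x y : EuclideanSpace ℝ (Fin 3)) : ⟪D (D x), y⟫ = x 0 * y 0 + x 1 * y 1 := by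
  simp [PiLp.inner_apply, Fin.sum_univ_three]
  ring

/-- `D` is symmetric. -/
theorem inner_D_symm (x y : EuclideanSpace ℝ (Fin 3)) : ⟪D x, y⟫ = ⟪x, D y⟫ := by
  rw [real_inner_comm (D y) x, inner_D, inner_D]; ring

/-- `trace D = 0` (incompressibility of the planar strain). -/
theorem trace_D : LinearMap.trace ℝ _ (D : EuclideanSpace ℝ (Fin 3) →ₗ[ℝ] EuclideanSpace ℝ (Fin 3)) = 0 := by
  rw [LinearMap.trace_eq_sum_inner _ (EuclideanSpace.basisFun (Fin 3) ℝ)]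
  simp [Fin.sum_univ_three, EuclideanSpace.inner_single_left]

/-! ## §2 The amplitude `a(t) = (κt + a₀⁻¹)⁻¹` -/

/-- support (definition): the amplitude `a(t) = (κt + a₀⁻¹)⁻¹` (so `a(0) = a₀`, `a′ = −κa²`). -/
def amp (κ a₀ t : ℝ) : ℝ := (κ * t + a₀⁻¹)⁻¹

/-- The denominator `κt + a₀⁻¹` is positive for `κ, a₀ > 0`, `t ≥ 0`. -/
theorem den_pos {κ a₀ t : ℝ} (hκ : 0 < κ) (ha₀ : 0 < a₀) (ht : 0 ≤ t) : 0 < κ * t + a₀⁻¹ := by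
  have : 0 ≤ κ * t := mul_nonneg hκ.le ht
  have : 0 < a₀⁻¹ := inv_pos.2 ha₀
  linarith

/-- The amplitude `a(t)` is positive for `κ, a₀ > 0`, `t ≥ 0`. -/
theorem amp_pos {κ a₀ t : ℝ} (hκ : 0 < κ) (ha₀ : 0 < a₀) (ht : 0 ≤ t) : 0 < amp κ a₀ t :=
  inv_pos.2 (den_pos hκ ha₀ ht)

/-- The amplitude decays: `a(t) ≤ a₀` for `t ≥ 0`. -/
theorem amp_le {κ a₀ t : ℝ} (hκ : 0 < κ) (ha₀ : 0 < a₀) (ht : 0 ≤ t) : amp κ a₀ t ≤ a₀ := by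
  have h : a₀⁻¹ ≤ κ * t + a₀⁻¹ := le_add_of_nonneg_left (mul_nonneg hκ.le ht)
  have := inv_anti₀ (inv_pos.2 ha₀) h
  simpa [amp] using this

/-- `a′(t) = −κ a(t)²` wherever the denominator is nonzero. -/
theorem hasDerivAt_amp {κ a₀ t : ℝ} (h : κ * t + a₀⁻¹ ≠ 0) :
    HasDerivAt (amp κ a₀) (-κ * amp κ a₀ t ^ 2) t := by
  have h1 : HasDerivAt (fun s => κ * s + a₀⁻¹) (κ * 1) t :=
    ((hasDerivAt_id t).const_mul κ).add_const a₀⁻¹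
  have h2 := h1.inv h
  refine h2.congr_deriv ?_
  rw [amp, inv_pow, div_eq_mul_inv]
  ring

/-- The amplitude is smooth on `[0,T)`. -/
theorem contDiffOn_amp {κ a₀ T : ℝ} (hκ : 0 < κ) (ha₀ : 0 < a₀) : ContDiffOn ℝ ∞ (amp κ a₀) (Ico 0 T) := by
  have h : ContDiffOn ℝ ∞ (fun s : ℝ => κ * s + a₀⁻¹) (Ico 0 T) :=
    (contDiffOn_const.mul contDiffOn_id).add contDiffOn_const
  exact h.inv fun s hs => (den_pos hκ ha₀ hs.1).ne'

/-! ## §3 The flow: `S(t) = a(t) D`, `S′(t) = −κ a(t)² D`, `u = S x`, Craik–Criminale pressure -/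

/-- support (definition): `S(t) = a(t)·D`. -/
def S (κ a₀ : ℝ) (t : ℝ) : EuclideanSpace ℝ (Fin 3) →L[ℝ] EuclideanSpace ℝ (Fin 3) := amp κ a₀ t • D

/-- support (definition): `S′(t) = −κ a(t)²·D`. -/
def S' (κ a₀ : ℝ) (t : ℝ) : EuclideanSpace ℝ (Fin 3) →L[ℝ] EuclideanSpace ℝ (Fin 3) := (-κ * amp κ a₀ t ^ 2) • D

/-- support (definition): the velocity `u(t,x) = a(t)(x₀, −x₁, 0)`. -/
def u (κ a₀ : ℝ) : ℝ → EuclideanSpace ℝ (Fin 3) → EuclideanSpace ℝ (Fin 3) :=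
  LinearFlow.velocity (S κ a₀) (fun _ => 0)

/-- support (definition): the pressure `p(t,x) = −½⟪x, (S′ + S²)(t) x⟫`. -/
def p (κ a₀ : ℝ) : ℝ → EuclideanSpace ℝ (Fin 3) → ℝ :=
  LinearFlow.pressure (S κ a₀) (S' κ a₀) (fun _ => 0) (fun _ => 0) (fun _ => 0)

/-- `u(t,x) = a(t) D x` (unfolding lemma). -/
theorem u_apply (κ a₀ t : ℝ) (x : EuclideanSpace ℝ (Fin 3)) : u κ a₀ t x = amp κ a₀ t • D x := by
  simp [u, S]

/-- The flow fixes the origin: `u(t,0) = 0`. -/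
theorem u_apply_zero (κ a₀ t : ℝ) : u κ a₀ t 0 = 0 := by
  simp [u_apply]

/-- The velocity gradient is `∇u(t,·) ≡ a(t) D`. -/
theorem fderiv_u (κ a₀ t : ℝ) (x : EuclideanSpace ℝ (Fin 3)) : fderiv ℝ (u κ a₀ t) x = amp κ a₀ t • D := by
  rw [u, LinearFlow.fderiv_velocity]; rfl

/-- The Craik–Criminale matrix `S′ + S²` is symmetric (both are multiples of `D`, `D²`). -/
theorem inner_cc (κ a₀ t : ℝ) (x y : EuclideanSpace ℝ (Fin 3)) :
    ⟪LinearFlow.ccMatrix (S κ a₀) (S' κ a₀) t x, y⟫ =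
      (-κ * amp κ a₀ t ^ 2) * (x 0 * y 0 - x 1 * y 1) + amp κ a₀ t ^ 2 * (x 0 * y 0 + x 1 * y 1) := by
  rw [LinearFlow.ccMatrix_apply, S, S']
  show ⟪(-κ * amp κ a₀ t ^ 2) • D x + amp κ a₀ t • D (amp κ a₀ t • D x), y⟫ = _
  rw [map_smul, smul_smul, inner_add_left, real_inner_smul_left, real_inner_smul_left, inner_D, inner_D_D]
  ring

/-- Symmetry of the Craik–Criminale matrix as an inner-product identity. -/
theorem cc_symm (κ a₀ t : ℝ) (x y : EuclideanSpace ℝ (Fin 3)) :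
    ⟪LinearFlow.ccMatrix (S κ a₀) (S' κ a₀) t x, y⟫ = ⟪x, LinearFlow.ccMatrix (S κ a₀) (S' κ a₀) t y⟫ := by
  rw [real_inner_comm (LinearFlow.ccMatrix (S κ a₀) (S' κ a₀) t y) x, inner_cc, inner_cc]; ring

/-- `S(t) = a(t) D` is trace-free (incompressibility). -/
theorem trace_S (κ a₀ t : ℝ) :
    LinearMap.trace ℝ _ (S κ a₀ t : EuclideanSpace ℝ (Fin 3) →ₗ[ℝ] EuclideanSpace ℝ (Fin 3)) = 0 := by
  rw [S, ContinuousLinearMap.toLinearMap_smul, map_smul, trace_D, smul_zero]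

/-- **The decaying planar strain is a classical Navier–Stokes solution on `[0,T) × ℝ³`** for every viscosity
(force `0`), by the tree's Craik–Criminale theorem `LinearFlow.isClassicalNSSolutionOn`. -/
theorem isClassicalNSSolutionOn {κ a₀ : ℝ} (hκ : 0 < κ) (ha₀ : 0 < a₀) (ν T : ℝ) :
    IsClassicalNSSolutionOn (Ico 0 T) ν 0 (u κ a₀) (p κ a₀) := by
  have hamp := contDiffOn_amp (T := T) hκ ha₀
  have hSc : ContDiffOn ℝ ∞ (S κ a₀) (Ico 0 T) := hamp.smul contDiffOn_const
  have hS'c : ContDiffOn ℝ ∞ (S' κ a₀) (Ico 0 T) :=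
    (contDiffOn_const.mul (hamp.pow 2)).smul contDiffOn_const
  have hdS : ∀ t ∈ Ico 0 T, HasDerivWithinAt (S κ a₀) (S' κ a₀ t) (Ico 0 T) t := by
    intro t ht
    have h := (hasDerivAt_amp (κ := κ) (a₀ := a₀) (t := t) (den_pos hκ ha₀ ht.1).ne').smul_const D
    exact h.hasDerivWithinAt
  have hdU : ∀ t ∈ Ico 0 T, HasDerivWithinAt (fun _ : ℝ => (0 : EuclideanSpace ℝ (Fin 3))) 0 (Ico 0 T) t :=
    fun t _ => hasDerivWithinAt_const t _ _
  have h := LinearFlow.isClassicalNSSolutionOn (S κ a₀) (S' κ a₀) (fun _ => 0) (fun _ => 0) (fun _ => 0)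
    (uniqueDiffOn_Ico 0 T) ν hSc hS'c contDiffOn_const contDiffOn_const contDiffOn_const hdS hdU
    (fun t _ => trace_S κ a₀ t) (fun t _ => cc_symm κ a₀ t)
  exact h

/-- The velocity gradient is bounded on `[0,T)`: `‖∇u(t,x)‖ ≤ a₀‖D‖`. -/
theorem fderiv_bound {κ a₀ : ℝ} (hκ : 0 < κ) (ha₀ : 0 < a₀) {t : ℝ} (ht : 0 ≤ t)
    (x : EuclideanSpace ℝ (Fin 3)) : ‖fderiv ℝ (u κ a₀ t) x‖ ≤ a₀ * ‖D‖ := by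
  rw [fderiv_u, norm_smul, Real.norm_of_nonneg (amp_pos hκ ha₀ ht).le]
  exact mul_le_mul_of_nonneg_right (amp_le hκ ha₀ ht) (norm_nonneg _)

/-! ## §4 Strain form, vorticity, pressure Hessian and feed of the flow -/

/-- `⟪∇u(t,x)e,e⟫ = a(t)(e₀² − e₁²)` (independent of `x`). -/
theorem strainQuad_u (κ a₀ t : ℝ) (x e : EuclideanSpace ℝ (Fin 3)) :
    strainQuad (u κ a₀) t x e = amp κ a₀ t * (e 0 ^ 2 - e 1 ^ 2) := by
  rw [strainQuad, fderiv_u]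
  show ⟪amp κ a₀ t • D e, e⟫ = _
  rw [real_inner_smul_left, inner_D]
  ring

/-- The flow is irrotational: `curl u(t,·) ≡ 0`. -/
theorem curl_u (κ a₀ t : ℝ) (x : EuclideanSpace ℝ (Fin 3)) : curl (u κ a₀ t) x = 0 := by
  ext i
  fin_cases i <;> simp [curl, fderiv_u]

/-- `∇p(t,·) = −(S′ + S²)(t)·`, hence `∇²p(t,x) = −(S′ + S²)(t)`. -/
theorem fderiv_gradient_p (κ a₀ t : ℝ) (x : EuclideanSpace ℝ (Fin 3)) :
    fderiv ℝ (gradient (p κ a₀ t)) x = -(LinearFlow.ccMatrix (S κ a₀) (S' κ a₀) t) := by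
  have hg : gradient (p κ a₀ t) = fun y => -(LinearFlow.ccMatrix (S κ a₀) (S' κ a₀) t y) := by
    funext y
    rw [p, LinearFlow.gradient_pressure (S κ a₀) (S' κ a₀) (fun _ => 0) (fun _ => 0) (fun _ => 0)
      (cc_symm κ a₀ t) y]
    simp
  rw [hg]
  exact ((LinearFlow.ccMatrix (S κ a₀) (S' κ a₀) t).hasFDerivAt.neg).fderiv

/-- The strain feed of the flow: `H(t,x,e) = a(t)²((1−κ)e₀² + (1+κ)e₁²)`. -/
theorem strainFeed_u (κ a₀ t : ℝ) (x e : EuclideanSpace ℝ (Fin 3)) :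
    strainFeed (u κ a₀) (p κ a₀) t x e = amp κ a₀ t ^ 2 * ((1 - κ) * e 0 ^ 2 + (1 + κ) * e 1 ^ 2) := by
  rw [strainFeed, curl_u, pressureHess, fderiv_gradient_p]
  show (1 / 4 : ℝ) * (‖(0 : EuclideanSpace ℝ (Fin 3))‖ ^ 2 - ⟪(0 : EuclideanSpace ℝ (Fin 3)), e⟫ ^ 2) -
      ⟪-(LinearFlow.ccMatrix (S κ a₀) (S' κ a₀) t e), e⟫ = _
  rw [inner_neg_left, inner_cc]
  simp
  ring

/-! ## §5 The penalised maximisers are exactly `(0, ±e₀)` -/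

/-- `‖e‖² = e₀² + e₁² + e₂²` in `ℝ³`. -/
private theorem norm_sq_coords (e : EuclideanSpace ℝ (Fin 3)) : ‖e‖ ^ 2 = e 0 ^ 2 + e 1 ^ 2 + e 2 ^ 2 := by
  rw [EuclideanSpace.real_norm_sq_eq, Fin.sum_univ_three]

/-- `(0, e₀)` is an exact `ε`-penalised strain maximiser at every time with `a(t) > 0`. -/
theorem isStrainPenalisedArgmax_origin {κ a₀ ε t : ℝ} (hε : 0 < ε) (ha : 0 < amp κ a₀ t) :
    IsStrainPenalisedArgmax ε (u κ a₀) t 0 (EuclideanSpace.single 0 1) := by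
  refine ⟨by simp, fun y e' he' => ?_⟩
  rw [strainQuad_u, strainQuad_u]
  have hn := norm_sq_coords e'
  rw [he', one_pow] at hn
  have hw0 : 0 < (1 + ε * ‖y‖ ^ 2)⁻¹ := by positivity
  have hw1 : (1 + ε * ‖y‖ ^ 2)⁻¹ ≤ 1 := inv_le_one_of_one_le₀ (by nlinarith [norm_nonneg y])
  have hq : amp κ a₀ t * (e' 0 ^ 2 - e' 1 ^ 2) ≤ amp κ a₀ t := by nlinarith [sq_nonneg (e' 1), sq_nonneg (e' 2)]
  have hrhs : (1 + ε * ‖(0 : EuclideanSpace ℝ (Fin 3))‖ ^ 2)⁻¹ *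
      (amp κ a₀ t * ((EuclideanSpace.single 0 (1 : ℝ) : EuclideanSpace ℝ (Fin 3)) 0 ^ 2 -
        (EuclideanSpace.single 0 (1 : ℝ) : EuclideanSpace ℝ (Fin 3)) 1 ^ 2)) = amp κ a₀ t := by
    simp
  rw [hrhs]
  by_cases hsgn : 0 ≤ amp κ a₀ t * (e' 0 ^ 2 - e' 1 ^ 2)
  · calc (1 + ε * ‖y‖ ^ 2)⁻¹ * (amp κ a₀ t * (e' 0 ^ 2 - e' 1 ^ 2))
        ≤ 1 * (amp κ a₀ t * (e' 0 ^ 2 - e' 1 ^ 2)) := mul_le_mul_of_nonneg_right hw1 hsgn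
      _ ≤ amp κ a₀ t := by rw [one_mul]; exact hq
  · have : (1 + ε * ‖y‖ ^ 2)⁻¹ * (amp κ a₀ t * (e' 0 ^ 2 - e' 1 ^ 2)) ≤ 0 :=
      mul_nonpos_of_nonneg_of_nonpos hw0.le (lt_of_not_ge hsgn).le
    linarith

/-- Conversely every exact `ε`-penalised maximiser sits at the origin along `±e₀`. -/
theorem eq_of_isStrainPenalisedArgmax {κ a₀ ε t : ℝ} (hε : 0 < ε) (ha : 0 < amp κ a₀ t)
    {x e : EuclideanSpace ℝ (Fin 3)} (h : IsStrainPenalisedArgmax ε (u κ a₀) t x e) :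
    x = 0 ∧ e 0 ^ 2 = 1 ∧ e 1 = 0 ∧ e 2 = 0 := by
  obtain ⟨he, hmax⟩ := h
  have hn := norm_sq_coords e
  rw [he, one_pow] at hn
  have hm := hmax 0 (EuclideanSpace.single 0 1) (by simp)
  rw [strainQuad_u, strainQuad_u] at hm
  have hlhs : (1 + ε * ‖(0 : EuclideanSpace ℝ (Fin 3))‖ ^ 2)⁻¹ *
      (amp κ a₀ t * ((EuclideanSpace.single 0 (1 : ℝ) : EuclideanSpace ℝ (Fin 3)) 0 ^ 2 -
        (EuclideanSpace.single 0 (1 : ℝ) : EuclideanSpace ℝ (Fin 3)) 1 ^ 2)) = amp κ a₀ t := by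
    simp
  rw [hlhs] at hm
  set w := (1 + ε * ‖x‖ ^ 2)⁻¹ with hw
  have hw0 : 0 < w := by positivity
  have hden : 1 ≤ 1 + ε * ‖x‖ ^ 2 := by nlinarith [norm_nonneg x]
  have hw1 : w ≤ 1 := inv_le_one_of_one_le₀ hden
  -- `a ≤ w a (e₀² − e₁²)` with `a > 0`, `w ∈ (0,1]`, `e₀² − e₁² ≤ 1 − 2e₁² − e₂²`
  have hd : 1 ≤ w * (e 0 ^ 2 - e 1 ^ 2) := by
    by_contra hlt
    rw [not_le] at hlt
    have : w * (amp κ a₀ t * (e 0 ^ 2 - e 1 ^ 2)) < amp κ a₀ t := by nlinarith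
    linarith
  have hdiff : e 0 ^ 2 - e 1 ^ 2 ≤ 1 := by nlinarith [sq_nonneg (e 1), sq_nonneg (e 2)]
  have hw_eq : w = 1 := by
    apply le_antisymm hw1
    nlinarith
  have hx : x = 0 := by
    have h1 : 1 + ε * ‖x‖ ^ 2 = 1 := by
      have := hw_eq
      rw [hw] at this
      have h' : (1 + ε * ‖x‖ ^ 2)⁻¹ * (1 + ε * ‖x‖ ^ 2) = 1 := inv_mul_cancel₀ (by positivity)
      rw [this, one_mul] at h'
      exact h'
    have h2 : ‖x‖ ^ 2 = 0 := by nlinarith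
    have h3 : ‖x‖ = 0 := pow_eq_zero_iff (n := 2) (by norm_num) |>.1 h2
    exact norm_eq_zero.1 h3
  rw [hw_eq, one_mul] at hd
  have he1 : e 1 = 0 := by nlinarith [sq_nonneg (e 1), sq_nonneg (e 2)]
  have he2 : e 2 = 0 := by nlinarith [sq_nonneg (e 1), sq_nonneg (e 2)]
  refine ⟨hx, ?_, he1, he2⟩
  rw [he1, he2] at hn
  linarith

/-! ## §6 D1's hypothesis holds — with EQUALITY — and is charged at every time -/

/-- At every exact penalised maximiser the TOTAL feed equals `c·q²` (`c = 1 − κ`): `x̄ = 0`, `ē = ±e₀`,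
`u(t,0) = 0` (no drift), `q = a(t)`, `H = (1−κ)a(t)²`. -/
theorem totalFeed_eq_of_isStrainPenalisedArgmax {κ a₀ ε t : ℝ} (hε : 0 < ε) (ha : 0 < amp κ a₀ t)
    {x e : EuclideanSpace ℝ (Fin 3)} (h : IsStrainPenalisedArgmax ε (u κ a₀) t x e) :
    strainFeed (u κ a₀) (p κ a₀) t x e + Real.sqrt ε * ‖u κ a₀ t x‖ * strainQuad (u κ a₀) t x e =
      (1 - κ) * strainQuad (u κ a₀) t x e ^ 2 := by
  obtain ⟨hx, he0, he1, _⟩ := eq_of_isStrainPenalisedArgmax hε ha h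
  subst hx
  rw [strainFeed_u, strainQuad_u, u_apply_zero, norm_zero, he0, he1]
  ring

/-- **D1's hypothesis is met by the flow**, in D1's exact binder shape (`c = 1 − κ`), at EVERY level `ℓ`
(the level restriction is not even used: the total feed is `c·q²` at every penalised maximiser). -/
theorem driftCharged_hypothesis {κ a₀ ε : ℝ} (hκ : 0 < κ) (ha₀ : 0 < a₀) (hε : 0 < ε) (ℓ T : ℝ) :
    ∀ t ∈ Ico (0 : ℝ) T, ∀ (x e : EuclideanSpace ℝ (Fin 3)), IsStrainPenalisedArgmax ε (u κ a₀) t x e →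
      ℓ < (1 + ε * ‖x‖ ^ 2)⁻¹ * strainQuad (u κ a₀) t x e →
      strainFeed (u κ a₀) (p κ a₀) t x e + Real.sqrt ε * ‖u κ a₀ t x‖ * strainQuad (u κ a₀) t x e ≤
        (1 - κ) * strainQuad (u κ a₀) t x e ^ 2 :=
  fun _ ht _ _ hpen _ => (totalFeed_eq_of_isStrainPenalisedArgmax hε (amp_pos hκ ha₀ ht.1) hpen).le

/-- **The hypothesis is charged at every time**: `(0,e₀)` is a penalised maximiser with weighted strain
`a(t) = (κt + a₀⁻¹)⁻¹ ≥ (κT + a₀⁻¹)⁻¹` on `[0,T)`; so for every level `ℓ < (κT + a₀⁻¹)⁻¹` the charge set is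
non-empty at all times (D1 is not vacuously satisfied). -/
theorem charged_origin {κ a₀ ε : ℝ} (hκ : 0 < κ) (ha₀ : 0 < a₀) (hε : 0 < ε) (T : ℝ) :
    ∀ t ∈ Ico (0 : ℝ) T,
      IsStrainPenalisedArgmax ε (u κ a₀) t 0 (EuclideanSpace.single 0 1) ∧
      (1 + ε * ‖(0 : EuclideanSpace ℝ (Fin 3))‖ ^ 2)⁻¹ * strainQuad (u κ a₀) t 0 (EuclideanSpace.single 0 1)
        = (κ * t + a₀⁻¹)⁻¹ ∧
      (κ * T + a₀⁻¹)⁻¹ < (κ * t + a₀⁻¹)⁻¹ := by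
  intro t ht
  refine ⟨isStrainPenalisedArgmax_origin hε (amp_pos hκ ha₀ ht.1), ?_, ?_⟩
  · rw [strainQuad_u]
    simp [amp]
  · exact inv_strictAnti₀ (den_pos hκ ha₀ ht.1) (by nlinarith [ht.2])

end PlanarStrain

/-! ## §7 Packaged in D1's binder shapes: `DriftChargedSmoothing` is inhabited (and its `1/(κt)` is sharp) -/

open PlanarStrain in
/-- **Satisfiability certificate for D1 «DriftChargedSmoothing»** (`t₀ = 0`). For every `ν`, `T`, `ε > 0`,
level `ℓ`, constant `c < 1` (`κ = 1 − c`) and initial amplitude `a₀ > 0`, the decaying planar strain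
`u(t,x) = (κt + a₀⁻¹)⁻¹(x₀,−x₁,0)` with its Craik–Criminale pressure
(i) is a classical Navier–Stokes solution on `[0,T) × ℝ³` with force `0` (D1's frame, first clause);
(ii) has velocity gradient bounded on every `[0,T′]`, `T′ < T` (D1's frame, second clause);
(iii) satisfies D1's total-feed hypothesis at every charged exact `ε`-penalised maximiser (with equality);
(iv) charges the hypothesis at every time `t ∈ [0,T)` whenever `ℓ < (κT + a₀⁻¹)⁻¹`: `(0,e₀)` is a penalised
maximiser with weighted strain `(κt + a₀⁻¹)⁻¹ > (κT + a₀⁻¹)⁻¹`.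
D1's conclusion at `(t,0,e₀)` therefore reads `(κt + a₀⁻¹)⁻¹ ≤ ℓ + 6νε/κ + (κt)⁻¹` — sharp as `a₀ → ∞`. -/
theorem driftChargedSmoothing_inhabited (ν T ε ℓ c a₀ : ℝ) (hε : 0 < ε) (hc : c < 1) (ha₀ : 0 < a₀) :
    IsClassicalNSSolutionOn (Ico 0 T) ν 0 (u (1 - c) a₀) (p (1 - c) a₀) ∧
    (∀ T' : ℝ, T' < T → ∃ K : ℝ, ∀ t ∈ Icc (0 : ℝ) T', ∀ x : EuclideanSpace ℝ (Fin 3),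
        ‖fderiv ℝ (u (1 - c) a₀ t) x‖ ≤ K) ∧
    (∀ t ∈ Ico (0 : ℝ) T, ∀ (x e : EuclideanSpace ℝ (Fin 3)), IsStrainPenalisedArgmax ε (u (1 - c) a₀) t x e →
        ℓ < (1 + ε * ‖x‖ ^ 2)⁻¹ * strainQuad (u (1 - c) a₀) t x e →
        strainFeed (u (1 - c) a₀) (p (1 - c) a₀) t x e
            + Real.sqrt ε * ‖u (1 - c) a₀ t x‖ * strainQuad (u (1 - c) a₀) t x e ≤
          c * strainQuad (u (1 - c) a₀) t x e ^ 2) ∧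
    (∀ t ∈ Ico (0 : ℝ) T,
        IsStrainPenalisedArgmax ε (u (1 - c) a₀) t 0 (EuclideanSpace.single 0 1) ∧
        (1 + ε * ‖(0 : EuclideanSpace ℝ (Fin 3))‖ ^ 2)⁻¹ *
            strainQuad (u (1 - c) a₀) t 0 (EuclideanSpace.single 0 1) = ((1 - c) * t + a₀⁻¹)⁻¹ ∧
        ((1 - c) * T + a₀⁻¹)⁻¹ < ((1 - c) * t + a₀⁻¹)⁻¹) := by
  have hκ : 0 < 1 - c := by linarith
  refine ⟨PlanarStrain.isClassicalNSSolutionOn hκ ha₀ ν T, fun T' _ => ⟨a₀ * ‖D‖, fun t ht x =>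
    fderiv_bound hκ ha₀ ht.1 x⟩, fun t ht x e hpen hlev => ?_, charged_origin hκ ha₀ hε T⟩
  have h := driftCharged_hypothesis hκ ha₀ hε ℓ T t ht x e hpen hlev
  have hc' : (1 - (1 - c)) = c := by ring
  rw [hc'] at h
  exact h

end

end Summit.NavierStokesRegularity.NavierStokesRegularity.Theorems.StrainDoors
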